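/- Copyright: the b2b-balaban cell (near-miss cell 7), T⁴-continuum fan-out, lineage t4-ne7b-formalise-leaf-04 (NE7b
ROUND-2 crew, leaf prover 04).  Released under the licence of the surrounding project. -/
import Literature.MathematicalPhysics.QuantumFieldTheory.Balaban1983to89.B16Cor3Ops

/-!
# Positive additive operations RELATIVE TO A GOOD CLASS of functions — re-open object (α) of row NE7b, `SCOPE-alpha.md`
v2.2 §5 row M1 (operator side), part 1 of 2; crux-team module of lineage `t4-ne7b-formalise-leaf-04` gen 23 under the
coordinator ruling «YM redirect» (crux node NE7b, route R-P1 «EXTRACTION ∕ GENEALOGY») — PRE-POSITIONING ONLY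

Summits-side support leaf of the T⁴-continuum cell (rung (B)+1 on a FINITE torus only; NOT infinite volume, NOT the
mass gap, NOT Clay; NOT a proof of NE7b — the cell's OWN estimate, NOT PRINTED, NOT PROVED).  [folklore] order ∕ sum
algebra over gen 4's certified `B16Cor3Ops` (GAPS C-pv06-4); nothing printed asserted, no `def … : Prop` fact of
Bałaban's, no cite-tagged hypothesis, zero `sorry`.  (1.73) p. 380 of B16 = [Balaban1989LargeFieldII] (UNDER AUDIT) is
quoted as CONTEXT with `B16Cor3Ops`'s locators (render `…/1989-cmp122-large-field-II-p026-x2.png`).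

WHY.  (1.72) p. 379 nests HISTORY SUMS inside its operations; to pull them out (part 2) the operations must be ADDITIVE,
`T(F + G) = TF + TG`, besides monotone and homogeneous (the two properties (1.73) uses, gen 4's `PosOp`).  Asking the three
laws on ALL real functions of the configuration admits FINITE positive kernels only (a finite gauge group: `kernelR`) — no
integral operator of a compact group is monotone on all functions (junk values of the integral on non-integrable inputs).
So the laws are asked on a GOOD CLASS `𝒢` only (model: bounded measurable functions — an algebra with the constants), the
operation preserving the class: `RelLinPosOp 𝒢`.  The Bochner fibre integral against a finite measure with a bounded
measurable kernel IS such an operation (lineage probe `g23/q1/RelPosOpProbe`, Mathlib only, off-tree) — the form in which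
(1.72) can be INSTANTIATED for `G = SU(2)` by M2∕M4.  Here: `GoodClass` (`top`, `sum`), `RelLinPosOp` (`ofPosOp`, `kernelR`),
(1.73) in relative form (`abs_apply_le`), `map_sum`, the instances `idR`∕`compR`∕`mulR`∕`sumR`∕`piR`, (1.73) iterated
(`piR_one_le`).

HONEST.  Proves nothing of Bałaban's; BY-NAME EFFECT ON THE WALL (`WALL-NE7b-P1.md` §2): NONE; NE7b NOT proved; spine 0∕9.
HONEST DEPENDENCY (cell): continuum YM on T⁴ ⇐ BetaPertH ∧ nine spine estimates (0/9 proved); BetaPertH ⇐ (D1) ∧ (D4) ∧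
CAP+tail; G-an2-4 gates asym, D1 and NE2/3/4.  This file changes none of it.
-/

open Finset
open Literature.MathematicalPhysics.QuantumFieldTheory.Balaban1983to89
open Literature.MathematicalPhysics.QuantumFieldTheory.Balaban1983to89.B16Cor3Ops

namespace Summit.QuantumFields.BalabanUV.T4Continuum.B16HistoryIndexedRepr

/-! ## 1. Good classes and relative additive positive operations -/

/-- A GOOD CLASS of real functions of the configuration: contains the constants and is closed under sums, scalar
multiples and pointwise products (model: bounded measurable functions). [folklore] -/
structure GoodClass (C : Type*) where
  Gd : (C → ℝ) → Prop
  const : ∀ c : ℝ, Gd (fun _ => c)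
  add : ∀ {F G : C → ℝ}, Gd F → Gd G → Gd (fun x => F x + G x)
  smul : ∀ {F : C → ℝ} (c : ℝ), Gd F → Gd (fun x => c * F x)
  mul : ∀ {F G : C → ℝ}, Gd F → Gd G → Gd (fun x => F x * G x)

namespace GoodClass

variable {C : Type*} (𝒢 : GoodClass C)

/-- The class of ALL functions (the case of finite kernels ∕ a finite gauge group). [folklore] -/
def top (C : Type*) : GoodClass C where
  Gd _ := True
  const _ := trivial
  add _ _ := trivial
  smul _ _ := trivial
  mul _ _ := trivial

/-- Finite sums of good functions are good. [folklore] -/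
theorem sum {ι : Type*} (s : Finset ι) (F : ι → C → ℝ) (hF : ∀ i ∈ s, 𝒢.Gd (F i)) :
    𝒢.Gd (fun x => ∑ i ∈ s, F i x) := by
  classical
  induction s using Finset.induction_on with
  | empty => simpa using 𝒢.const 0
  | insert a s ha ih =>
      have h := 𝒢.add (hF a (Finset.mem_insert_self a s)) (ih fun i hi => hF i (Finset.mem_insert_of_mem hi))
      simpa [Finset.sum_insert ha] using h

end GoodClass

/-- A POSITIVE ADDITIVE OPERATION RELATIVE TO THE GOOD CLASS `𝒢`: `T` is defined on all functions (junk outside the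
class) and is required to PRESERVE the class and to be monotone, additive and homogeneous ON IT — the three properties of
an integral against a positive density, asked where an integral has them. [folklore] -/
structure RelLinPosOp {C : Type*} (𝒢 : GoodClass C) where
  T : (C → ℝ) → C → ℝ
  map_good : ∀ {F : C → ℝ}, 𝒢.Gd F → 𝒢.Gd (T F)
  mono : ∀ {F G : C → ℝ}, 𝒢.Gd F → 𝒢.Gd G → (∀ x, F x ≤ G x) → ∀ x, T F x ≤ T G x
  add : ∀ {F G : C → ℝ}, 𝒢.Gd F → 𝒢.Gd G → ∀ x, T (fun y => F y + G y) x = T F x + T G x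
  smul : ∀ {F : C → ℝ}, 𝒢.Gd F → ∀ (c : ℝ) (x : C), T (fun y => c * F y) x = c * T F x

/-- A TOTAL positive operation of gen 4 (`B16Cor3Ops.PosOp`: monotone and homogeneous on ALL functions) that is
moreover additive is a relative one for the class of all functions — the case of FINITE positive kernels (a finite gauge
group). [folklore] -/
def RelLinPosOp.ofPosOp {C : Type*} (P : PosOp C)
    (hadd : ∀ (F G : C → ℝ) (x : C), P.T (fun y => F y + G y) x = P.T F x + P.T G x) :
    RelLinPosOp (GoodClass.top C) where
  T := P.T
  map_good _ := trivial
  mono := fun _ _ h x => P.mono _ _ h x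
  add := fun _ _ x => hadd _ _ x
  smul := fun _ c x => P.smul c _ x

/-- The finite positive kernel `(TF)(x) = Σ_{ω∈S} K(x,ω) F(φ_ω x)`, `K ≥ 0` (gen 4's `PosOp.ofKernel`) as a relative operation
on all functions: the interface is inhabited (for a compact group the inhabitant is the Bochner fibre integral relative
to bounded measurable functions — the lineage's off-tree probe, not imported here). [folklore] -/
def RelLinPosOp.kernelR {C Ω : Type*} (S : Finset Ω) (K : C → Ω → ℝ) (φ : Ω → C → C) (hK : ∀ x ω, 0 ≤ K x ω) :
    RelLinPosOp (GoodClass.top C) :=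
  RelLinPosOp.ofPosOp (PosOp.ofKernel S K φ hK) fun F G x => by
    show ∑ ω ∈ S, K x ω * (F (φ ω x) + G (φ ω x)) =
      ∑ ω ∈ S, K x ω * F (φ ω x) + ∑ ω ∈ S, K x ω * G (φ ω x)
    rw [← Finset.sum_add_distrib]
    exact Finset.sum_congr rfl fun ω _ => by ring

namespace RelLinPosOp

variable {C : Type*} {𝒢 : GoodClass C}

/-- `T 0 = 0`. [folklore] -/
theorem map_zero (P : RelLinPosOp 𝒢) (x : C) : P.T (fun _ => 0) x = 0 := by
  have h := P.smul (𝒢.const 0) 0 x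
  simpa using h

/-- Positivity on the class: `F ≥ 0` good ⟹ `TF ≥ 0`. [folklore] -/
theorem apply_nonneg (P : RelLinPosOp 𝒢) {F : C → ℝ} (hF : 𝒢.Gd F) (h : ∀ y, 0 ≤ F y) (x : C) : 0 ≤ P.T F x := by
  have h1 := P.mono (𝒢.const 0) hF h x
  rwa [P.map_zero] at h1

/-- `T1 ≥ 0`. [folklore] -/
theorem one_nonneg (P : RelLinPosOp 𝒢) (x : C) : 0 ≤ P.T (fun _ => 1) x :=
  P.apply_nonneg (𝒢.const 1) (fun _ => zero_le_one) x

/-- `F ≤ B` good ⟹ `TF ≤ B·T1`. [folklore] -/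
theorem apply_le_of_le (P : RelLinPosOp 𝒢) {F : C → ℝ} (hF : 𝒢.Gd F) {B : ℝ} (h : ∀ y, F y ≤ B) (x : C) :
    P.T F x ≤ B * P.T (fun _ => 1) x := by
  have h1 := P.mono hF (𝒢.smul B (𝒢.const 1)) (fun y => by simpa using h y) x
  rwa [P.smul (𝒢.const 1)] at h1

/-- `B ≤ F` good ⟹ `B·T1 ≤ TF`. [folklore] -/
theorem le_apply_of_le (P : RelLinPosOp 𝒢) {F : C → ℝ} (hF : 𝒢.Gd F) {B : ℝ} (h : ∀ y, B ≤ F y) (x : C) :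
    B * P.T (fun _ => 1) x ≤ P.T F x := by
  have h1 := P.mono (𝒢.smul B (𝒢.const 1)) hF (fun y => by simpa using h y) x
  rwa [P.smul (𝒢.const 1)] at h1

/-- **(1.73) relative form**: `F` good, `|F| ≤ B` ⟹ `|TF| ≤ B·T1`. [folklore] -/
theorem abs_apply_le (P : RelLinPosOp 𝒢) {F : C → ℝ} (hF : 𝒢.Gd F) {B : ℝ} (h : ∀ y, |F y| ≤ B) (x : C) :
    |P.T F x| ≤ B * P.T (fun _ => 1) x := by
  rw [abs_le]
  refine ⟨?_, P.apply_le_of_le hF (fun y => (abs_le.mp (h y)).2) x⟩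
  have h1 := P.le_apply_of_le hF (B := -B) (fun y => (abs_le.mp (h y)).1) x
  linarith

/-- Additivity over finite sums of good functions. [folklore] -/
theorem map_sum (P : RelLinPosOp 𝒢) {ι : Type*} (s : Finset ι) (F : ι → C → ℝ) (hF : ∀ i ∈ s, 𝒢.Gd (F i)) (x : C) :
    P.T (fun y => ∑ i ∈ s, F i y) x = ∑ i ∈ s, P.T (F i) x := by
  classical
  induction s using Finset.induction_on with
  | empty => simpa using P.map_zero x
  | insert a s ha ih =>
      have hs : ∀ i ∈ s, 𝒢.Gd (F i) := fun i hi => hF i (Finset.mem_insert_of_mem hi)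
      simp only [Finset.sum_insert ha]
      rw [← ih hs]
      exact P.add (hF a (Finset.mem_insert_self a s)) (𝒢.sum s F hs) x

/-- The identity. [folklore] -/
def idR (𝒢 : GoodClass C) : RelLinPosOp 𝒢 where
  T F := F
  map_good h := h
  mono _ _ h x := h x
  add _ _ _ := rfl
  smul _ _ _ := rfl

/-- Composition. [folklore] -/
def compR (P Q : RelLinPosOp 𝒢) : RelLinPosOp 𝒢 where
  T F := P.T (Q.T F)
  map_good h := P.map_good (Q.map_good h)
  mono hF hG h x := P.mono (Q.map_good hF) (Q.map_good hG) (fun y => Q.mono hF hG h y) x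
  add {F G} hF hG x := by
    show P.T (Q.T (fun y => F y + G y)) x = P.T (Q.T F) x + P.T (Q.T G) x
    have e : Q.T (fun y => F y + G y) = fun y => Q.T F y + Q.T G y := funext fun y => Q.add hF hG y
    rw [e, P.add (Q.map_good hF) (Q.map_good hG)]
  smul {F} hF c x := by
    show P.T (Q.T (fun y => c * F y)) x = c * P.T (Q.T F) x
    have e : Q.T (fun y => c * F y) = fun y => c * Q.T F y := funext fun y => Q.smul hF c y
    rw [e, P.smul (Q.map_good hF)]

/-- Multiplication by a non-negative GOOD function (characteristic functions). [folklore] -/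
def mulR (m : C → ℝ) (hm : 𝒢.Gd m) (hm0 : ∀ x, 0 ≤ m x) : RelLinPosOp 𝒢 where
  T F x := m x * F x
  map_good h := 𝒢.mul hm h
  mono _ _ h x := mul_le_mul_of_nonneg_left (h x) (hm0 x)
  add _ _ x := by
    show m x * (_ + _) = _
    ring
  smul _ c x := by
    show m x * (c * _) = c * (m x * _)
    ring

/-- A finite sum of relative operations (the exposed history sums). [folklore] -/
def sumR {H : Type*} (S : Finset H) (ops : H → RelLinPosOp 𝒢) : RelLinPosOp 𝒢 where
  T F x := ∑ h ∈ S, (ops h).T F x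
  map_good hF := 𝒢.sum S _ fun h _ => (ops h).map_good hF
  mono hF hG h x := Finset.sum_le_sum fun i _ => (ops i).mono hF hG h x
  add hF hG x := by
    show ∑ h ∈ S, (ops h).T _ x = ∑ h ∈ S, (ops h).T _ x + ∑ h ∈ S, (ops h).T _ x
    rw [← Finset.sum_add_distrib]
    exact Finset.sum_congr rfl fun i _ => (ops i).add hF hG x
  smul hF c x := by
    show ∑ h ∈ S, (ops h).T _ x = c * ∑ h ∈ S, (ops h).T _ x
    rw [Finset.mul_sum]
    exact Finset.sum_congr rfl fun i _ => (ops i).smul hF c x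

/-- The composite of a list of relative operations. [folklore] -/
def piR {δ : Type*} (ops : δ → RelLinPosOp 𝒢) : List δ → RelLinPosOp 𝒢
  | [] => idR 𝒢
  | d :: l => compR (ops d) (piR ops l)

/-- **(1.73) iterated, relative form**: `T_d 1 ≤ w_d` for every factor ⟹ `(T_{d₁}∘⋯∘T_{d_n})1 ≤ Π_i w_{d_i}`. [folklore] -/
theorem piR_one_le {δ : Type*} (ops : δ → RelLinPosOp 𝒢) (w : δ → ℝ) (hw : ∀ d x, (ops d).T (fun _ => 1) x ≤ w d) :
    ∀ (l : List δ) (x : C), (piR ops l).T (fun _ => 1) x ≤ (l.map w).prod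
  | [], x => by
      show (1 : ℝ) ≤ (([] : List δ).map w).prod
      simp
  | d :: l, x => by
      have hwnn : ∀ d', 0 ≤ w d' := fun d' => ((ops d').one_nonneg x).trans (hw d' x)
      have hprod : 0 ≤ (l.map w).prod :=
        List.prod_nonneg fun a ha => by
          obtain ⟨d', -, rfl⟩ := List.mem_map.mp ha
          exact hwnn d'
      show (ops d).T ((piR ops l).T fun _ => 1) x ≤ ((d :: l).map w).prod
      rw [List.map_cons, List.prod_cons]
      calc (ops d).T ((piR ops l).T fun _ => 1) x ≤ (l.map w).prod * (ops d).T (fun _ => 1) x :=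
            (ops d).apply_le_of_le ((piR ops l).map_good (𝒢.const 1)) (fun y => piR_one_le ops w hw l y) x
        _ ≤ (l.map w).prod * w d := mul_le_mul_of_nonneg_left (hw d x) hprod
        _ = w d * (l.map w).prod := mul_comm _ _

end RelLinPosOp

end Summit.QuantumFields.BalabanUV.T4Continuum.B16HistoryIndexedRepr
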